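import Summits.BirchSwinnertonDyer.BirchSwinnertonDyer.Theorems.PrintCf2SplitBadTwoQuadraticPart
import Summits.BirchSwinnertonDyer.BirchSwinnertonDyer.Theorems.EisensteinPrimesGoodLatticeHeckeCharOfTeichmuller
import Literature.NumberTheory.Automorphic.ArtinLFunctionsAbelianConductorProofs
import Literature.NumberTheory.GaloisRepresentations.HeckeCharacterCofiniteProofs
import HarnessLib

/-!
# The sign character as S3a's `θ`-binder: a finite-order framed character `Γ_K → GL₁(𝓞)` of ANY
# exponent has a Hecke character by PRIMITIVE Artin reciprocity (exact ramification), and at `p = 2`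
# the sign `θ̂` of a continuous `χ : Γ_K → ℤ₂ˣ` is such a character with `θ² = 1`
# (width brick B11b = O4 glue of the v10 frame / the `θ_W` of v9.1 S3a, road α)

Cell `bsd-print-cf2`, seat `bsd-line-cf2-p1-w4` g7, crux `stmt-BirchSwinnertonDyer-20368`
`PrintCf2.SplitBadTwoRankOneOfFacts`.  Theses-free; `--supports` the crux.  S3a
(`stub_twoVariableMC_two`) binds `θ : FramedGaloisRep K (padicCoeffIntegers ∅) 1`, `0 < n`,
`∀ σ, θ σ ^ n = 1`, `θK : HeckeCharacter K`, `KellerYin2024.IsHeckeCharOf ι θ θK` and an exact tame set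
`S ∌ v, v̄` of `θK`; its docstring: "the branch road α needs is `θ = θ_W :=` the finite (order-2) part
of the `𝔭₀`-adic avatar of `ψ_W`".  File `…QuadraticPart` (B11) produced that order-2 part as a
continuous SIGN character `θ̂ : Γ_K →ₜ* ℤ₂ˣ` (`exists_signChar`) and killed the principal part on the
`ℤ₂²`-tower kernel.  THIS FILE turns `θ̂` into S3a's binders:

* §1 (any `p`, any number field, ANY exponent `n > 0`) — the tree's
  `EisensteinPrimesMuLambda.exists_heckeCharacter_of_pow_eq_one` covers only `θ^{p−1} = 1` (empty at
  `p = 2`), its continuity step being Teichmüller rigidity.  Here: `isOpen_setOf_entry_eq_one` (the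
  `n`-th roots of unity of `ℚ̄_p` other than `1` form a finite, hence closed, set, so `{σ : θ(σ)₀₀ = 1}`
  is open — no norm estimate), `exists_complexification_of_pow_eq_one` (`ι ∘ θ : Γ_K → GL₁(ℂ)` is a
  continuous Artin character), **`exists_heckeChar_of_pow_eq_one`** (from the tree's PRIMITIVE
  reciprocity `Automorphic.artinReciprocity_character_primitive_holds`: `∃ θK` of finite order with
  `IsHeckeCharOf ι θ θK` AND `θK` unramified at `w ↔ θ` unramified at `w`), and
  `exists_exactTameSet` (any Hecke character: a finite `S ∌ v, v̄` carrying exactly the ramification off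
  `v, v̄` — `HeckeCharacter.isUnramifiedAt_cofinite_holds`).
* §2 (`p = 2`) `exists_framed_of_signChar`: a `{±1}`-valued continuous `θ̂ : Γ_K →ₜ* ℤ₂ˣ` IS a framed
  `θ : Γ_K →ₜ* GL₁(𝓞_{ℚ₂(S)})` with `θ² = 1`, entries `θ̂(σ) ∈ ℤ₂ ⊂ 𝓞` and `θ σ = 1 ↔ θ̂ σ = 1`;
  **`exists_signChar_framed_heckeChar`** (O3 + O4 assembled for an imaginary quadratic `K`): for every
  continuous `χ : Γ_K →ₜ* ℤ₂ˣ` there are its sign `θ̂`, the framed `θ` (`θ² = 1`), a finite-order `θK`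
  with `IsHeckeCharOf ι θ θK` and exact ramification `θK ↔ θ ↔ θ̂`, and `χ·θ̂ = 1` on `pairKer κ₁ κ₂` of
  EVERY generator pair of the `ℤ₂²`-tower.  What is NOT here: O2′ (the avatar of `(ψ∘c)⁻¹` is
  `ℤ₂ˣ`-valued) and the product of avatars (-w5's `IsPAdicAvatarOf.mul_twist`).

HONEST FRAMING: plumbing over the tree's class field theory (Artin reciprocity for characters, Tate's
finiteness of ramification); closes nothing; beyond-print theorem: no.  BSD is not proved by any of
this.

References: [CasselsFrohlichANT1967] Ch. VII §5.1 (A); [NeukirchANT1999] VII (10.6), VI (6.6);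
[TateThesis1967] Lemma 3.2.1; [Washington1997] §5.1; [deShalit1987] II.4.17 (54).
-/

-- the summit namespace `Summit.BirchSwinnertonDyer.BirchSwinnertonDyer` repeats the problem name by design (D-0017)
set_option linter.dupNamespace false
set_option autoImplicit false

noncomputable section

open scoped Classical

open Polynomial NumberField IsDedekindDomain Field
  Literature.NumberTheory.EllipticCurves Literature.NumberTheory.GaloisRepresentations
  Literature.NumberTheory.EllipticCurves.KellerYin2024
open Summit.BirchSwinnertonDyer.BirchSwinnertonDyer.Theorems.EisensteinPrimesMuLambda

namespace Summit.BirchSwinnertonDyer.BirchSwinnertonDyer.Theorems.PrintCf2.QuadraticPart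

universe u

/-! ## §1 Finite-order framed characters of any exponent: complexification and Hecke character -/

section FiniteOrder

variable {K : Type} [Field K] {p : ℕ} [hp : Fact p.Prime] (S : Set (PadicAlgCl p))
  (ι : PadicAlgCl p ≃+* ℂ)

/-- **`{σ : θ(σ)₀₀ = 1}` is open** for a continuous `θ : Γ_K → GL₁(𝓞)` of finite order `θⁿ = 1`,
`n > 0`: the entries are `n`-th roots of unity, a finite hence closed subset of `ℚ̄_p`, so the non-trivial
ones form a closed set avoided exactly on `{θ₀₀ = 1}`. [folklore] -/
theorem isOpen_setOf_entry_eq_one (θ : FramedGaloisRep K (padicCoeffIntegers S) 1) {n : ℕ}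
    (hn : 0 < n) (hθ : ∀ σ : absoluteGaloisGroup K, θ σ ^ n = 1) :
    IsOpen {σ : absoluteGaloisGroup K | entry S θ σ = 1} := by
  have hfin : Set.Finite {x : PadicAlgCl p | x ^ n = 1 ∧ x ≠ 1} := by
    refine (Multiset.finite_toSet (Polynomial.nthRoots n (1 : PadicAlgCl p))).subset ?_
    intro x hx
    exact (Polynomial.mem_nthRoots hn).mpr hx.1
  have hpow : ∀ σ : absoluteGaloisGroup K,
      ((entry S θ σ : padicCoeffIntegers S) : PadicAlgCl p) ^ n = 1 := fun σ ↦ by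
    have h := congrArg ((↑) : padicCoeffIntegers S → PadicAlgCl p)
      (entry_pow_eq_one_of_pow_eq_one S θ σ (hθ σ))
    push_cast at h
    exact h
  have heq : {σ : absoluteGaloisGroup K | entry S θ σ = 1} =
      (fun σ ↦ ((entry S θ σ : padicCoeffIntegers S) : PadicAlgCl p)) ⁻¹'
        {x : PadicAlgCl p | x ^ n = 1 ∧ x ≠ 1}ᶜ := by
    ext σ
    simp only [Set.mem_setOf_eq, Set.mem_preimage, Set.mem_compl_iff, not_and, not_not]
    constructor
    · intro h _
      rw [h, OneMemClass.coe_one]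
    · intro h
      exact OneMemClass.coe_eq_one.mp (h (hpow σ))
  rw [heq]
  exact hfin.isClosed.isOpen_compl.preimage (continuous_coe_entry S θ)

/-- **The complexification of a finite-order framed character is an Artin character** (any exponent
`n > 0`; the tree's `exists_complexification_of_pow_eq_one` is the case `n = p − 1`): a continuous
`χ : Γ_K → GL₁(ℂ)` with `χ(σ)₀₀ = ι(θ(σ)₀₀)` — continuity because `χ` is trivial on the open set
`{θ₀₀ = 1} ∋ 1`. [folklore] -/
theorem exists_complexification_of_pow_eq_one (θ : FramedGaloisRep K (padicCoeffIntegers S) 1)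
    {n : ℕ} (hn : 0 < n) (hθ : ∀ σ : absoluteGaloisGroup K, θ σ ^ n = 1) :
    ∃ χ : FramedGaloisRep K ℂ 1, ∀ σ : absoluteGaloisGroup K,
      (((χ σ : GL (Fin 1) ℂ) : Matrix (Fin 1) (Fin 1) ℂ) 0 0) =
        ι ((entry S θ σ : padicCoeffIntegers S) : PadicAlgCl p) := by
  -- the bare character `χ₀ = ι ∘ det ∘ θ : Γ_K →* ℂˣ`
  let χ₀ : absoluteGaloisGroup K →* ℂˣ :=
    (Units.map (ι : PadicAlgCl p →* ℂ)).comp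
      ((Units.map ((padicCoeffIntegers S).subtype : padicCoeffIntegers S →* PadicAlgCl p)).comp
        ((Matrix.GeneralLinearGroup.det :
            GL (Fin 1) (padicCoeffIntegers S) →* (padicCoeffIntegers S)ˣ).comp θ.toMonoidHom))
  have hχ₀ : ∀ σ, ((χ₀ σ : ℂˣ) : ℂ) = ι ((entry S θ σ : padicCoeffIntegers S) : PadicAlgCl p) := by
    intro σ
    rw [entry_eq_det]
    rfl
  have htriv : ∀ σ : absoluteGaloisGroup K, entry S θ σ = 1 → χ₀ σ = 1 := fun σ hσ ↦ by
    apply Units.ext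
    rw [hχ₀ σ, hσ, OneMemClass.coe_one, map_one, Units.val_one]
  -- continuity at `1`, hence everywhere
  have hcont : Continuous χ₀ := by
    apply continuous_of_continuousAt_one
    rw [ContinuousAt, map_one]
    intro A hA
    refine Filter.mem_map.mpr (Filter.mem_of_superset
      ((isOpen_setOf_entry_eq_one S θ hn hθ).mem_nhds ?_) fun σ hσ ↦ ?_)
    · exact entry_eq_one_of_apply_eq_one S θ (map_one θ)
    · rw [Set.mem_preimage, htriv σ hσ]
      exact mem_of_mem_nhds hA
  refine ⟨(FramedRep.unitsContinuousMulEquivOfUnique (Fin 1) ℂ : ℂˣ →ₜ* GL (Fin 1) ℂ).comp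
    ⟨χ₀, hcont⟩, fun σ ↦ ?_⟩
  rw [← hχ₀ σ]
  rfl

variable [NumberField K]

/-- **The Hecke character of a finite-order framed character, with EXACT ramification** (any prime
`p`, any exponent `n > 0`).  For `θ : Γ_K → GL₁(𝓞)` continuous with `θⁿ = 1` and `ι : ℚ̄_p ≃ ℂ` there
is a Hecke character `θK` of finite order with `KellerYin2024.IsHeckeCharOf ι θ θK` (at every `w`
where `θ` is unramified, `θK` is unramified and `θK(ϖ_w) = ι(θ(Frob_w^{arith}))`) AND `θK` is
unramified at `w` iff `θ` is — the tree's PRIMITIVE Artin reciprocity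
`Automorphic.artinReciprocity_character_primitive_holds` (Neukirch VII (10.6) with VI (6.6)) applied to
the complexification. [cite: NeukirchANT1999, Ch. VII §10 Thm. (10.6) and Ch. VI (6.6)]
[cite: CasselsFrohlichANT1967, Ch. VII §5.1 Main Theorem (A)] -/
theorem exists_heckeChar_of_pow_eq_one (θ : FramedGaloisRep K (padicCoeffIntegers S) 1) {n : ℕ}
    (hn : 0 < n) (hθ : ∀ σ : absoluteGaloisGroup K, θ σ ^ n = 1) :
    ∃ θK : HeckeCharacter K, θK.IsFiniteOrder ∧ IsHeckeCharOf ι θ θK ∧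
      ∀ w : HeightOneSpectrum (𝓞 K), θK.IsUnramifiedAt w ↔ θ.IsUnramifiedAt w := by
  obtain ⟨χ, hχ⟩ := exists_complexification_of_pow_eq_one S ι θ hn hθ
  -- `χ σ = 1 ↔ θ σ = 1`
  have hone : ∀ σ : absoluteGaloisGroup K, χ σ = 1 ↔ θ σ = 1 := fun σ ↦ by
    constructor
    · intro h
      apply apply_eq_one_of_entry_eq_one S θ σ
      have h1 := hχ σ
      rw [h, Units.val_one, Matrix.one_apply_eq] at h1
      have h2 : ((entry S θ σ : padicCoeffIntegers S) : PadicAlgCl p) = 1 :=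
        ι.injective (by rw [map_one]; exact h1.symm)
      exact OneMemClass.coe_eq_one.mp h2
    · intro h
      refine Matrix.GeneralLinearGroup.ext fun i j ↦ ?_
      rw [Subsingleton.elim i 0, Subsingleton.elim j 0, Units.val_one, Matrix.one_apply_eq, hχ σ,
        entry_eq_one_of_apply_eq_one S θ h, OneMemClass.coe_one, map_one]
  have hunr : ∀ w : HeightOneSpectrum (𝓞 K), χ.IsUnramifiedAt w ↔ θ.IsUnramifiedAt w := fun w ↦
    ⟨fun h 𝔓 h𝔓 σ hσ ↦ (hone σ).mp (h 𝔓 h𝔓 σ hσ), fun h 𝔓 h𝔓 σ hσ ↦ (hone σ).mpr (h 𝔓 h𝔓 σ hσ)⟩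
  obtain ⟨ω, hfin, hω⟩ :=
    Literature.NumberTheory.Automorphic.artinReciprocity_character_primitive_holds (K := K) χ
  refine ⟨ω, hfin, fun w hw ↦ ?_, fun w ↦ (hω w).1.trans (hunr w)⟩
  have hχw : χ.IsUnramifiedAt w := (hunr w).mpr hw
  refine ⟨(hω w).1.mpr hχw, fun a ha ↦ ?_⟩
  rw [FramedGaloisRep.hasFrobCharpolyAt_iff_of_rank_one] at ha
  obtain ⟨𝔓, h𝔓⟩ := w.primesAbove_nonempty
  obtain ⟨Φ, hΦ⟩ :=
    IsDedekindDomain.HeightOneSpectrum.exists_isArithFrobAt_of_mem_primesAbove_holds (K := K) (v := w) h𝔓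
  have h1 : entry S θ Φ = a := ha 𝔓 h𝔓 Φ hΦ
  have h2 := (hω w).2 hχw 𝔓 h𝔓 Φ hΦ
  rw [h2, FramedRep.det_apply, Matrix.GeneralLinearGroup.val_det_apply, Matrix.det_fin_one, hχ Φ, h1]

omit hp in
/-- **Exact tame set.**  For any Hecke character `θK` and places `v, v̄` there is a finite `S` with
`v, v̄ ∉ S`, `θK` ramified at every `w ∈ S`, and unramified at every `w ∉ S ∪ {v, v̄}` (Tate: a Hecke
character is unramified at all but finitely many places — `HeckeCharacter.isUnramifiedAt_cofinite_holds`).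
This is the `S`-binder shape of S3a / `IsKatzMeasure₂`. [cite: TateThesis1967, Lemma 3.2.1] -/
theorem exists_exactTameSet (θK : HeckeCharacter K) (v vbar : HeightOneSpectrum (𝓞 K)) :
    ∃ T : Finset (HeightOneSpectrum (𝓞 K)), v ∉ T ∧ vbar ∉ T ∧
      (∀ w ∈ T, ¬ θK.IsUnramifiedAt w) ∧
      ∀ w : HeightOneSpectrum (𝓞 K), w ∉ T → w ≠ v → w ≠ vbar → θK.IsUnramifiedAt w := by
  have hfin : Set.Finite {w : HeightOneSpectrum (𝓞 K) | ¬ θK.IsUnramifiedAt w} :=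
    HeckeCharacter.isUnramifiedAt_cofinite_holds θK
  have hfin' : Set.Finite {w : HeightOneSpectrum (𝓞 K) | ¬ θK.IsUnramifiedAt w ∧ w ≠ v ∧ w ≠ vbar} :=
    hfin.subset fun w hw ↦ hw.1
  refine ⟨hfin'.toFinset, ?_, ?_, fun w hw ↦ ?_, fun w hw hv hvbar ↦ ?_⟩
  · rw [Set.Finite.mem_toFinset]
    exact fun h ↦ h.2.1 rfl
  · rw [Set.Finite.mem_toFinset]
    exact fun h ↦ h.2.2 rfl
  · rw [Set.Finite.mem_toFinset] at hw
    exact hw.1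
  · rw [Set.Finite.mem_toFinset] at hw
    by_contra h
    exact hw ⟨h, hv, hvbar⟩

end FiniteOrder

/-! ## §2 At `p = 2`: the sign character as a framed `θ` with `θ² = 1`, and its Hecke character -/

section Two

variable {K : Type} [Field K] (S : Set (PadicAlgCl 2))

/-- The structure map `ℤ₂ → 𝓞_{ℚ₂(S)}` is continuous. [folklore] -/
private theorem continuous_padicIntToCoeff : Continuous (padicIntToCoeff S : ℤ_[2] → padicCoeffIntegers S) :=
  ((continuous_algebraMap ℚ_[2] (PadicAlgCl 2)).comp continuous_subtype_val).subtype_mk _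

/-- **A `{±1}`-valued continuous character is a framed character with `θ² = 1`.**  For
`θ̂ : Γ_K →ₜ* ℤ₂ˣ` with `θ̂(σ) ∈ {1, −1}` there is `θ : Γ_K →ₜ* GL₁(𝓞_{ℚ₂(S)})` with `θ(σ)² = 1`, entry
`θ(σ)₀₀ = θ̂(σ) ∈ ℤ₂ ⊂ 𝓞`, and `θ(σ) = 1 ↔ θ̂(σ) = 1` (`Γ_K → ℤ₂ˣ → 𝓞ˣ ≅ GL₁(𝓞)`, as the tree's
`KellerYin2024.teichmullerLiftOnQuot`). [cite: KellerYin2024, §1.1 (arXiv:2402.12781v2 TeX L441)] -/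
theorem exists_framed_of_signChar (θs : absoluteGaloisGroup K →ₜ* ℤ_[2]ˣ)
    (hθs : ∀ σ, θs σ = 1 ∨ θs σ = -1) :
    ∃ θ : FramedGaloisRep K (padicCoeffIntegers S) 1,
      (∀ σ, θ σ ^ 2 = 1) ∧ (∀ σ, entry S θ σ = padicIntToCoeff S ((θs σ : ℤ_[2]ˣ) : ℤ_[2])) ∧
      ∀ σ, θ σ = 1 ↔ θs σ = 1 := by
  let u : absoluteGaloisGroup K →* (padicCoeffIntegers S)ˣ :=
    (Units.map (padicIntToCoeff S : ℤ_[2] →* padicCoeffIntegers S)).comp θs.toMonoidHom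
  have huc : Continuous u :=
    (Continuous.units_map _ (continuous_padicIntToCoeff S)).comp θs.continuous
  have hu : ∀ σ, ((u σ : (padicCoeffIntegers S)ˣ) : padicCoeffIntegers S) =
      padicIntToCoeff S ((θs σ : ℤ_[2]ˣ) : ℤ_[2]) := fun σ ↦ rfl
  have hsq : ∀ σ, θs σ ^ 2 = 1 := fun σ ↦ by
    rcases hθs σ with h | h <;> rw [h] <;> simp
  let θ : FramedGaloisRep K (padicCoeffIntegers S) 1 :=
    (FramedRep.unitsContinuousMulEquivOfUnique (Fin 1) (padicCoeffIntegers S) :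
        (padicCoeffIntegers S)ˣ →ₜ* GL (Fin 1) (padicCoeffIntegers S)).comp ⟨u, huc⟩
  have hθ : ∀ σ, θ σ = FramedRep.unitsContinuousMulEquivOfUnique (Fin 1) (padicCoeffIntegers S) (u σ) :=
    fun σ ↦ rfl
  have hentry : ∀ σ, entry S θ σ = padicIntToCoeff S ((θs σ : ℤ_[2]ˣ) : ℤ_[2]) := fun σ ↦ by
    rw [entry, hθ, FramedRep.unitsContinuousMulEquivOfUnique_apply_coe, hu]
  have hu2 : ∀ σ, u σ ^ 2 = 1 := fun σ ↦ by
    change (Units.map (padicIntToCoeff S : ℤ_[2] →* padicCoeffIntegers S)) (θs σ) ^ 2 = 1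
    rw [← map_pow, hsq, map_one]
  refine ⟨θ, fun σ ↦ ?_, hentry, fun σ ↦ ⟨fun h ↦ ?_, fun h ↦ ?_⟩⟩
  · rw [hθ, ← map_pow, hu2 σ, map_one]
  · rcases hθs σ with h1 | h1
    · exact h1
    · exfalso
      have he := entry_eq_one_of_apply_eq_one S θ h
      rw [hentry, h1, Units.val_neg, Units.val_one, map_neg, map_one] at he
      have he' := congrArg ((↑) : padicCoeffIntegers S → PadicAlgCl 2) he
      push_cast at he'
      norm_num at he'
  · have hu1 : u σ = 1 := by
      change (Units.map (padicIntToCoeff S : ℤ_[2] →* padicCoeffIntegers S)) (θs σ) = 1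
      rw [h, map_one]
    rw [hθ, hu1, map_one]

variable [NumberField K] (ι : PadicAlgCl 2 ≃+* ℂ)

/-- **O3 + O4 for a `ℤ₂ˣ`-valued character of an imaginary quadratic field (S3a's `θ`-binder from the
sign).**  `K` imaginary quadratic, `χ : Γ_K →ₜ* ℤ₂ˣ` continuous (e.g. the avatar of `(ψ∘c)⁻¹` when it is
`ℤ₂ˣ`-valued): there are its SIGN `θ̂` (values `±1`, `χθ̂ ≡ 1 (mod 4)`), a framed
`θ : Γ_K →ₜ* GL₁(𝓞_{ℚ₂(S)})` with `θ² = 1` and `θ σ = 1 ↔ θ̂ σ = 1`, a finite-order Hecke character `θK`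
with `KellerYin2024.IsHeckeCharOf ι θ θK` and `θK` unramified at `w ↔ θ` unramified at `w`, such that
`χ(σ)·θ̂(σ) = 1` for every `σ ∈ pairKer κ₁ κ₂` of EVERY generator pair of the `ℤ₂²`-tower — the
principal part `⟨χ⟩ = χ·θ̂` factors through `Gal(K̃_∞/K)`.  (Exponent for S3a: `n = 2`; exact tame set:
`exists_exactTameSet θK v v̄`.) [cite: NeukirchANT1999, Ch. VII §10 Thm. (10.6)]
[cite: Washington1997, §5.1 and Thm. 13.4] [cite: deShalit1987, II.4.17 (54)] -/
theorem exists_signChar_framed_heckeChar (hK : IsImaginaryQuadratic K)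
    (χ : absoluteGaloisGroup K →ₜ* ℤ_[2]ˣ) :
    ∃ (θs : absoluteGaloisGroup K →ₜ* ℤ_[2]ˣ) (θ : FramedGaloisRep K (padicCoeffIntegers S) 1)
      (θK : HeckeCharacter K),
      (∀ σ, θs σ = 1 ∨ θs σ = -1) ∧ (∀ σ, (4 : ℤ_[2]) ∣ (χ σ : ℤ_[2]) * (θs σ : ℤ_[2]) - 1) ∧
      (∀ σ, θ σ ^ 2 = 1) ∧ (∀ σ, θ σ = 1 ↔ θs σ = 1) ∧
      (∀ σ, entry S θ σ = padicIntToCoeff S ((θs σ : ℤ_[2]ˣ) : ℤ_[2])) ∧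
      θK.IsFiniteOrder ∧ IsHeckeCharOf ι θ θK ∧
      (∀ w : HeightOneSpectrum (𝓞 K), θK.IsUnramifiedAt w ↔ θ.IsUnramifiedAt w) ∧
      ∀ {κ₁ κ₂ : ZpExtension K 2} {γ₁ γ₂ : absoluteGaloisGroup K},
        ZpExtension.IsTopGeneratorPair κ₁ κ₂ γ₁ γ₂ →
        ∀ {σ : absoluteGaloisGroup K}, σ ∈ ZpExtension.pairKer κ₁ κ₂ → χ σ * θs σ = 1 := by
  obtain ⟨θs, hθs, -, hθsχ, hker⟩ := exists_signChar_mul_apply_eq_one_of_isImaginaryQuadratic hK χ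
  obtain ⟨θ, hθ2, hentry, hθ1⟩ := exists_framed_of_signChar S θs hθs
  obtain ⟨θK, hfin, hHecke, hram⟩ := exists_heckeChar_of_pow_eq_one S ι θ two_pos hθ2
  exact ⟨θs, θ, θK, hθs, hθsχ, hθ2, hθ1, hentry, hfin, hHecke, hram,
    fun hpair _ hσ ↦ hker hpair hσ⟩

end Two

end Summit.BirchSwinnertonDyer.BirchSwinnertonDyer.Theorems.PrintCf2.QuadraticPart

end
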